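import Mathlib
import HarnessLib
import Literature.MathematicalPhysics.QuantumLattice.HubbardEffectiveActionCTSpinFlip
import Summits.HubbardSuperconductivity.HubbardSuperconductivity.Theorems.KLProgrammeKLRegimeVolumeLimitOneFrame
import Summits.HubbardSuperconductivity.HubbardSuperconductivity.Theorems.KLProgrammeKLRegimeVolumeLimitFrameCovariance
import Summits.HubbardSuperconductivity.HubbardSuperconductivity.Theorems.KLProgrammeKLRegimeVolumeLimitExDefs

/-!
# Child `KLRegimeVolumeLimitV12` (stmt-HubbardSuperconductivity-19858), registered stub `stub_vl_bound` — the DOOR: the stub follows from ONE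
# bare-frame, spin-`↑`, own-threshold uniform bound on the fully integrated two-leg kernel (seat hubbard-kl-k3c5-p3,
# technique «OS-positivity-free direct assembly»)

The registered `stub_vl_bound` asks, for every constant record, regime point `(μ, U, β)`, admissible frame `K` and tower, for a bound
`∃ B L₀ Mth, ∀ L ≥ L₀, ∀ M ≥ Mth L, ∀ (k, σ), ‖klSelfEnergy L M β U μ K klE0 (nScales β + 1) k σ‖ ≤ B` with the PROVER'S OWN Matsubara
threshold `Mth` (slot `FinalTwoLegVolLimitEx`).  Two reductions, both unconditional and for EVERY real `U`:
* `§1` SPIN: the kernel is spin independent (`klSelfEnergy_nScales_succ_spin_eq`, BGM §2.1 symmetry (1) for `𝒢^K_Λ`,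
  `Literature.…HubbardEffectiveActionCTSpinFlip`), so spin `↑` suffices;
* `§2` FRAME: a uniform bound in ONE frame `K'` beyond own thresholds gives one in ANY frame `K` beyond the SAME thresholds, with
  `B ↦ (1 + δβ/π)²·B + δ(1 + δβ/π)`, `δ = ‖K‖ + ‖K'‖` (k3c5-p2's frame covariance `selfEnergy_fullActionCT_frame_covariance` and dressing bound
  `norm_shift_ratio_le`, `…VolumeLimitFrameCovariance`; junk-zero when `D = 0`, `…VolumeLimitOneFrame`) — `norm_klSelfEnergy_frame_transfer`,
  `uniformBound_frame_transfer`;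
* `§3` THE DOOR `stub_vl_bound_of_bareFrameBound`: IF for every `β > 0`, `U`, `μ` there are `B₀ L₀ Mth` with
  `‖klSelfEnergy L M β U μ 0 klE0 (nScales β + 1) k 0‖ ≤ B₀` for all `L ≥ L₀`, `M ≥ Mth L`, `k` (bare frame, spin `↑`), THEN the registered
  `stub_vl_bound` text holds VERBATIM (its tower / frame / regime hypotheses are not even used).  With `…VolumeLimitOccupation`
  (`norm_klSelfEnergy_bare_sub_sixPoint_le_eventually`: the order-`U` half, ∀`U`) and `…SixPointWordIntegral`
  (`norm_sixPoint_up_le_integral_word`: label-uniform `L¹`-majorant of the current–current half), the ONE remaining input of `stub_vl_bound`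
  is (Z): an `M`-eventual, `L`-uniform bound on `βL²·∫₀^β Σ_z ‖∫e^{−V_M}·sixPointWord L M β 0 1 z u‖ du / ‖D_M‖`-type control of the word
  six-point function — the 3+3-leg all-`U` Matsubara limit on k3c5-p1's `…SixPointDefs` interface plus ‖T_k‖ ≤ 1 (k3c5-p2).
Everything is proved; no definition.
-/

noncomputable section

namespace Summit.HubbardSuperconductivity.HubbardSuperconductivity.Theorems.TwoPointAssembly

set_option linter.dupNamespace false -- summit = problem name (single-conjunct summit), D-0017

open Finset Filter Topology Literature.MathematicalPhysics.QuantumLattice Literature.Probability.LatticeModels GrassmannAlgebra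
open Summit.HubbardSuperconductivity.HubbardSuperconductivity.Theorems.KLRegimeSplit
open Summit.HubbardSuperconductivity.HubbardSuperconductivity.Theorems.KLProgrammeLegKernels

variable {L M : ℕ} [NeZero L]

/-! ## §1 Spin independence of the VL carrier -/

/-- **The fully integrated two-leg kernel is spin independent**: `Σ̂^K_{L,M}(k,σ) = Σ̂^K_{L,M}(k,↑)` (every `β, U, μ, K, L, M`). -/
theorem klSelfEnergy_nScales_succ_spin_eq (β U μ : ℝ) (K : TrigPolyC4v) (n : ℕ) (k : FreqMomentum L M) (σ : Fin 2) :
    klSelfEnergy L M β U μ K klE0 n k σ = klSelfEnergy L M β U μ K klE0 n k 0 := by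
  rw [klSelfEnergy, klSelfEnergy, klEffectiveAction]
  exact selfEnergy_hubbardEffectiveActionCT_spin_eq L M β U μ K _ k σ

/-! ## §2 A uniform bound transfers between frames (own thresholds kept) -/

/-- **Pointwise frame transfer of a bound** (`β > 0`): if `‖Σ̂^{K'}(k,σ)‖ ≤ B` with `0 ≤ B` then
`‖Σ̂^K(k,σ)‖ ≤ (1 + δβ/π)²·B + δ·(1 + δβ/π)`, `δ = ‖K‖₀ + ‖K'‖₀` (sup-norm majorants `coeffNorm 0`). -/
theorem norm_klSelfEnergy_frame_transfer {β : ℝ} (hβ : 0 < β) (U μ : ℝ) (K K' : TrigPolyC4v) (k : FreqMomentum L M) (σ : Fin 2)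
    {B : ℝ} (hB : 0 ≤ B) (h : ‖klSelfEnergy L M β U μ K' klE0 (nScales β + 1) k σ‖ ≤ B) :
    ‖klSelfEnergy L M β U μ K klE0 (nScales β + 1) k σ‖ ≤
      (1 + (K.coeffNorm 0 + K'.coeffNorm 0) * (β / Real.pi)) ^ 2 * B +
        (K.coeffNorm 0 + K'.coeffNorm 0) * (1 + (K.coeffNorm 0 + K'.coeffNorm 0) * (β / Real.pi)) := by
  set δ : ℝ := K.coeffNorm 0 + K'.coeffNorm 0 with hδ
  set Bd : ℝ := 1 + δ * (β / Real.pi) with hBd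
  have hK0 : 0 ≤ K.coeffNorm 0 := TrigPolyC4v.coeffNorm_nonneg 0 K
  have hK0' : 0 ≤ K'.coeffNorm 0 := TrigPolyC4v.coeffNorm_nonneg 0 K'
  have hδ0 : 0 ≤ δ := add_nonneg hK0 hK0'
  have hBd1 : 1 ≤ Bd := by rw [hBd]; nlinarith [div_pos hβ Real.pi_pos]
  have hBd0 : 0 ≤ Bd := zero_le_one.trans hBd1
  by_cases hD : effPartitionFn ℂ (hubbardCovariance L M β μ 0) (hubbardInteraction L M β U) = 0
  · rw [klSelfEnergy_nScales_succ_eq_zero_of_partitionFn_eq_zero hβ U μ K hD, norm_zero]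
    positivity
  -- the frame covariance identity and the dressing bound
  have hcov : klSelfEnergy L M β U μ K klE0 (nScales β + 1) k σ =
      (propCT L M β μ K' k / propCT L M β μ K k) ^ 2 * klSelfEnergy L M β U μ K' klE0 (nScales β + 1) k σ +
        ((K.eval (latticeMomentum L k.2) - K'.eval (latticeMomentum L k.2) : ℝ) : ℂ) *
          (propCT L M β μ K' k / propCT L M β μ K k) := by
    rw [klSelfEnergy, klSelfEnergy, klEffectiveAction_nScales_succ L M hβ U μ K, klEffectiveAction_nScales_succ L M hβ U μ K',
      ← fullActionCT, ← fullActionCT]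
    exact selfEnergy_fullActionCT_frame_covariance hβ.ne' U μ K K' k σ hD
  have hδK : |K.eval (latticeMomentum L k.2) - K'.eval (latticeMomentum L k.2)| ≤ δ :=
    (abs_sub _ _).trans (add_le_add (TrigPolyC4v.abs_eval_le_coeffNorm K _) (TrigPolyC4v.abs_eval_le_coeffNorm K' _))
  have hdr : ‖propCT L M β μ K' k / propCT L M β μ K k‖ ≤ Bd := by
    rw [propCT_div_propCT_eq hβ.ne']
    refine (norm_shift_ratio_le hβ _ (pi_div_le_abs_matsubaraFreq hβ k.1) _ _).trans ?_
    rw [hBd]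
    have hab : |nambuXiCT L μ K k.2 - nambuXiCT L μ K' k.2| ≤ δ := by
      rw [nambuXiCT_eq_add_frame_sub μ K K' k.2, show ∀ a b : ℝ, a - (a + b) = -b from fun a b => by ring, abs_neg]
      exact hδK
    gcongr
  rw [hcov]
  refine (norm_add_le _ _).trans (add_le_add ?_ ?_)
  · rw [norm_mul, norm_pow]
    exact mul_le_mul (pow_le_pow_left₀ (norm_nonneg _) hdr 2) h (norm_nonneg _) (by positivity)
  · rw [norm_mul, Complex.norm_real, Real.norm_eq_abs]
    exact mul_le_mul hδK hdr (norm_nonneg _) hδ0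

/-- **A uniform bound beyond own thresholds transfers between frames**: from frame `K'` to frame `K`, same thresholds, explicit constant. -/
theorem uniformBound_frame_transfer {β : ℝ} (hβ : 0 < β) (U μ : ℝ) (K K' : TrigPolyC4v) {B : ℝ} {L₀ : ℕ} {Mth : ℕ → ℕ}
    (h : ∀ (L : ℕ) [NeZero L], L₀ ≤ L → ∀ (M : ℕ) [NeZero M], Mth L ≤ M →
      ∀ (k : FreqMomentum L M) (σ : Fin 2), ‖klSelfEnergy L M β U μ K' klE0 (nScales β + 1) k σ‖ ≤ B) :
    ∀ (L : ℕ) [NeZero L], L₀ ≤ L → ∀ (M : ℕ) [NeZero M], Mth L ≤ M →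
      ∀ (k : FreqMomentum L M) (σ : Fin 2), ‖klSelfEnergy L M β U μ K klE0 (nScales β + 1) k σ‖ ≤
        (1 + (K.coeffNorm 0 + K'.coeffNorm 0) * (β / Real.pi)) ^ 2 * max B 0 +
          (K.coeffNorm 0 + K'.coeffNorm 0) * (1 + (K.coeffNorm 0 + K'.coeffNorm 0) * (β / Real.pi)) := by
  intro L _ hL M _ hM k σ
  exact norm_klSelfEnergy_frame_transfer hβ U μ K K' k σ (le_max_right _ _) ((h L hL M hM k σ).trans (le_max_left _ _))

/-! ## §3 The door: `stub_vl_bound` from the bare-frame, spin-`↑` uniform bound -/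

/-- `klBetaMin ≤ β ⟹ 0 < β`. -/
theorem pos_of_klBetaMin_le {β : ℝ} (hβ : klBetaMin ≤ β) : 0 < β := by
  unfold klBetaMin at hβ; linarith

/-- **THE DOOR FOR `stub_vl_bound` OF `KLRegimeVolumeLimitV12`.**  If for every `β > 0`, `U`, `μ` the BARE-FRAME, SPIN-`↑` fully integrated
two-leg kernel is uniformly bounded beyond the prover's own thresholds,
`∃ B₀ L₀ Mth, ∀ L ≥ L₀, ∀ M ≥ Mth L, ∀ k, ‖klSelfEnergy L M β U μ 0 klE0 (nScales β + 1) k 0‖ ≤ B₀`,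
then the registered stub text holds verbatim (spin symmetry + frame transfer; the constant records, regime, admissibility of the frame and the
tower are not used). -/
theorem stub_vl_bound_of_bareFrameBound
    (hbare : ∀ β : ℝ, 0 < β → ∀ U μ : ℝ, ∃ B₀ : ℝ, ∃ L₀ : ℕ, ∃ Mth : ℕ → ℕ,
      ∀ (L : ℕ) [NeZero L], L₀ ≤ L → ∀ (M : ℕ) [NeZero M], Mth L ≤ M →
        ∀ k : FreqMomentum L M, ‖klSelfEnergy L M β U μ 0 klE0 (nScales β + 1) k 0‖ ≤ B₀) :
    ∀ (G : GeoConsts) (P : SplitConsts) (Q : EngConsts) (R : RenConsts), G.WF → P.WF → Q.WF → R.WF →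
      ∃ c₅ : ℝ, 0 < c₅ ∧ ∀ c : ℝ, 0 < c → c ≤ c₅ → ∃ U₀ : ℝ, 0 < U₀ ∧
        ∀ μ ∈ klWindowC, ∀ U : ℝ, 0 < U → U ≤ U₀ → ∀ β : ℝ, klBetaMin ≤ β → β ≤ Real.exp (c / U ^ 2) →
          ∀ K : TrigPolyC4v, klPredsV12.frameOK R U (nScales β) μ K →
            ∀ (Lstar : ℕ) (Mstar : ℕ → ℕ), TowerP klPredsV12 G P Q R β U μ K Lstar Mstar →
              ∃ B : ℝ, ∃ L₀ : ℕ, ∃ Mth : ℕ → ℕ, ∀ (L : ℕ) [NeZero L], L₀ ≤ L → ∀ (M : ℕ) [NeZero M], Mth L ≤ M →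
                ∀ (k : FreqMomentum L M) (σ : Fin 2), ‖klSelfEnergy L M β U μ K klE0 (nScales β + 1) k σ‖ ≤ B := by
  intro G P Q R _ _ _ _
  refine ⟨1, one_pos, fun c _ _ => ⟨1, one_pos, ?_⟩⟩
  intro μ _ U _ _ β hβmin _ K _ Lstar Mstar _
  have hβ : 0 < β := pos_of_klBetaMin_le hβmin
  obtain ⟨B₀, L₀, Mth, h0⟩ := hbare β hβ U μ
  -- all spins in the bare frame
  have h0' : ∀ (L : ℕ) [NeZero L], L₀ ≤ L → ∀ (M : ℕ) [NeZero M], Mth L ≤ M →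
      ∀ (k : FreqMomentum L M) (σ : Fin 2), ‖klSelfEnergy L M β U μ 0 klE0 (nScales β + 1) k σ‖ ≤ B₀ := by
    intro L _ hL M _ hM k σ
    rw [klSelfEnergy_nScales_succ_spin_eq]
    exact h0 L hL M hM k
  exact ⟨_, L₀, Mth, uniformBound_frame_transfer hβ U μ K 0 h0'⟩

end Summit.HubbardSuperconductivity.HubbardSuperconductivity.Theorems.TwoPointAssembly

end
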